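import Summits.QuantumFields.YangMills.Theorems.U1DipoleHelicityOptimalTestForm
import HarnessLib

/-!
# Route `TransverseWardBL`, support `BoxHodgeSplit` (stmt-QuantumFields-22932) — toolkit: the box potential and the swap symmetry

Lattice analysis on the four-torus `(ℤ/L)⁴` for the exact Hodge split of the box form (file `TransverseWardBLBoxHodgeSplit.lean`).
With the zero-mode-free torus Green function `G̃ = torusGreen` (`−ΔG̃ = 2(δ₀ − L⁻⁴)`, tree `sum_secondDiff_torusGreen`) and the
box `B_N = {−N,…,N}⁴ ⊂ ℤ⁴` projected to the torus, the **box potential** is `g(y) = ½ ∑_{x ∈ B_N} G̃(y − x̄)`: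

* §1 `(−Δ)g = c − #B_N/L⁴` with the fibre weights `c(y) = #{x ∈ B_N : x̄ = y}` (`poisson_boxPotential`);
* §2 the coordinate-pair swap `T(z₀,z₁,z₂,z₃) = (z₂,z₃,z₀,z₁)` preserves `G̃` (`torusGreen_swapPairs`), so it carries the
  `(0,1)` second differences of `G̃` to the `(2,3)` ones (`secondDiff01_torusGreen_swapPairs`);
* §3 double box sums of a kernel with a swap identity (`two_mul_sum_sum_box_of_add_swapPairs`, the trick of the tree's
  `U1DipoleHelicityFreeDipoleBoxMeanHalf` with a general right-hand side), injectivity of `B_N → (ℤ/L)⁴` for `L > 2N`;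
* §4 **the exact-sector sum**: `∑_y c(y)·(−Δ₀−Δ₁)g(y) = (#B_N − #B_N²/L⁴)/2` for `L > 2N` (`boxWeight_secondDiff01_sum`), and
  `∑_y c(y)² = #B_N`.

Free-hands width seat `ym-t4-w11` (cell ym-fleet) for planner ym-idea-4 g9 (LINE g9-A).  Elementary; nothing about the Yang–Mills mass
gap is proved.

References: J. Fröhlich, T. Spencer, Comm. Math. Phys. **83** (1982) 411, §2 [FrohlichSpencer1982].
-/

set_option autoImplicit false

noncomputable section

open Finset
open scoped BigOperators
open Literature.Probability.LatticeModels (Torus.proj box mem_box torusGreen latticeMomentum dispersion)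
open Literature.MathematicalPhysics.QuantumFieldTheory Literature.MathematicalPhysics.QuantumLattice
open Summit.QuantumFields.YangMills.Theorems.U1DipoleHelicity

namespace Summit.QuantumFields.YangMills.Theorems.TransverseWardBL

variable {L : ℕ} [NeZero L]

/-! ## §1 The box potential and its Poisson equation -/

omit [NeZero L] in
/-- `Torus.proj` is additive: `(x − y)‾ = x̄ − ȳ`. [folklore] -/
theorem torusProj_sub (x y : Literature.Probability.LatticeModels.Site 4) :
    Torus.proj L (x - y) = Torus.proj L x - Torus.proj L y := by
  funext i; simp [Torus.proj]

/-- **Poisson equation of the box potential** `g(y) = ½ ∑_{x ∈ B_N} G̃(y − x̄)`: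
`∑_μ (2g(y) − g(y+e_μ) − g(y−e_μ)) = #{x ∈ B_N : x̄ = y} − #B_N/L⁴`. [folklore] -/
theorem poisson_boxPotential (N : ℕ) (g : Site 4 L → ℝ)
    (hg : ∀ y : Site 4 L, g y = 1 / 2 * ∑ x ∈ box 4 N, torusGreen (y - Torus.proj L x)) (y : Site 4 L) :
    ∑ μ : Fin 4, (2 * g y - g (y + Pi.single μ 1) - g (y - Pi.single μ 1)) =
      (((box 4 N).filter (fun x => Torus.proj L x = y)).card : ℝ) - ((box 4 N).card : ℝ) / (L : ℝ) ^ 4 := by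
  have harg₁ : ∀ (μ : Fin 4) (x : Literature.Probability.LatticeModels.Site 4),
      y + Pi.single μ 1 - Torus.proj L x = (y - Torus.proj L x) + Pi.single μ 1 := fun μ x => by abel
  have harg₂ : ∀ (μ : Fin 4) (x : Literature.Probability.LatticeModels.Site 4),
      y - Pi.single μ 1 - Torus.proj L x = (y - Torus.proj L x) - Pi.single μ 1 := fun μ x => by abel
  simp_rw [hg, harg₁, harg₂]
  have hterm : ∀ μ : Fin 4,
      2 * (1 / 2 * ∑ x ∈ box 4 N, torusGreen (y - Torus.proj L x)) -
          1 / 2 * ∑ x ∈ box 4 N, torusGreen (y - Torus.proj L x + Pi.single μ 1) -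
          1 / 2 * ∑ x ∈ box 4 N, torusGreen (y - Torus.proj L x - Pi.single μ 1) =
        1 / 2 * ∑ x ∈ box 4 N, (2 * torusGreen (y - Torus.proj L x) - torusGreen (y - Torus.proj L x + Pi.single μ 1) -
          torusGreen (y - Torus.proj L x - Pi.single μ 1)) := by
    intro μ
    simp only [Finset.mul_sum]
    rw [← Finset.sum_sub_distrib, ← Finset.sum_sub_distrib]
    exact Finset.sum_congr rfl fun x _ => by ring
  rw [Finset.sum_congr rfl fun μ _ => hterm μ, ← Finset.mul_sum, Finset.sum_comm]
  simp_rw [sum_secondDiff_torusGreen, sub_eq_zero]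
  have hfilter : ((box 4 N).filter (fun x => y = Torus.proj L x)) = ((box 4 N).filter (fun x => Torus.proj L x = y)) :=
    Finset.filter_congr fun x _ => eq_comm
  rw [← Finset.mul_sum, Finset.sum_sub_distrib, Finset.sum_boole, Finset.sum_const, nsmul_eq_mul, hfilter]
  ring

/-! ## §2 The coordinate-pair swap preserves the torus Green function -/

omit [NeZero L] in
/-- The swap is an involution on torus sites. [folklore] -/
theorem swapPairs_swapPairs (z : Site 4 L) :
    (![(![z 2, z 3, z 0, z 1] : Site 4 L) 2, (![z 2, z 3, z 0, z 1] : Site 4 L) 3, (![z 2, z 3, z 0, z 1] : Site 4 L) 0,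
      (![z 2, z 3, z 0, z 1] : Site 4 L) 1] : Site 4 L) = z := by
  funext i; fin_cases i <;> simp

/-- **`G̃ ∘ T = G̃`**: the torus Green function is invariant under the coordinate-pair swap (reindex the momentum sum by the
same swap; the phase `p_k·z` and the dispersion `ε(p_k)` are symmetric functions of the coordinate pairs). [folklore] -/
theorem torusGreen_swapPairs (z : Site 4 L) :
    torusGreen (![z 2, z 3, z 0, z 1] : Site 4 L) = torusGreen z := by
  unfold torusGreen
  congr 1
  let e : Site 4 L ≃ Site 4 L :=
    { toFun := fun k => (![k 2, k 3, k 0, k 1] : Site 4 L)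
      invFun := fun k => (![k 2, k 3, k 0, k 1] : Site 4 L)
      left_inv := swapPairs_swapPairs
      right_inv := swapPairs_swapPairs }
  have he0 : ∀ k : Site 4 L, e k = 0 ↔ k = 0 := by
    intro k
    constructor
    · intro h
      have h' := congrArg e h
      have hee : e (e k) = k := swapPairs_swapPairs k
      rw [hee] at h'
      rw [h']
      funext i; fin_cases i <;> simp [e]
    · intro h
      rw [h]
      funext i; fin_cases i <;> simp [e]
  refine Finset.sum_equiv e (fun k => ?_) (fun k _ => ?_)
  · simp only [Finset.mem_erase, Finset.mem_univ, and_true, ne_eq, he0]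
  · have h1 : ∑ i : Fin 4, latticeMomentum L k i * ((((![z 2, z 3, z 0, z 1] : Site 4 L)) i).val : ℝ) =
        ∑ i : Fin 4, latticeMomentum L (e k) i * (((z i).val : ℝ)) := by
      simp only [Fin.sum_univ_four, latticeMomentum]
      simp [e]
      ring
    have h2 : dispersion (latticeMomentum L k) = dispersion (latticeMomentum L (e k)) := by
      unfold dispersion
      simp only [Fin.sum_univ_four, latticeMomentum]
      simp [e]
      ring
    rw [h1, h2]

omit [NeZero L] in
/-- `T z + e₀ = T(z + e₂)`, `T z − e₀ = T(z − e₂)`, `T z + e₁ = T(z + e₃)`, `T z − e₁ = T(z − e₃)` (coordinatewise). [folklore] -/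
theorem swapPairs_shift (z : Site 4 L) :
    ((![z 2, z 3, z 0, z 1] : Site 4 L) + Pi.single 0 1 =
        (![(z + Pi.single 2 1 : Site 4 L) 2, (z + Pi.single 2 1 : Site 4 L) 3, (z + Pi.single 2 1 : Site 4 L) 0, (z + Pi.single 2 1 : Site 4 L) 1] : Site 4 L)) ∧
      ((![z 2, z 3, z 0, z 1] : Site 4 L) - Pi.single 0 1 =
        (![(z - Pi.single 2 1 : Site 4 L) 2, (z - Pi.single 2 1 : Site 4 L) 3, (z - Pi.single 2 1 : Site 4 L) 0, (z - Pi.single 2 1 : Site 4 L) 1] : Site 4 L)) ∧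
      ((![z 2, z 3, z 0, z 1] : Site 4 L) + Pi.single 1 1 =
        (![(z + Pi.single 3 1 : Site 4 L) 2, (z + Pi.single 3 1 : Site 4 L) 3, (z + Pi.single 3 1 : Site 4 L) 0, (z + Pi.single 3 1 : Site 4 L) 1] : Site 4 L)) ∧
      ((![z 2, z 3, z 0, z 1] : Site 4 L) - Pi.single 1 1 =
        (![(z - Pi.single 3 1 : Site 4 L) 2, (z - Pi.single 3 1 : Site 4 L) 3, (z - Pi.single 3 1 : Site 4 L) 0, (z - Pi.single 3 1 : Site 4 L) 1] : Site 4 L)) := by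
  refine ⟨?_, ?_, ?_, ?_⟩ <;> (funext i; fin_cases i <;> simp)

/-- **The swap carries `(−Δ₀−Δ₁)G̃` to `(−Δ₂−Δ₃)G̃`**: `((−Δ₀−Δ₁)G̃)(Tz) = ((−Δ₂−Δ₃)G̃)(z)`. [folklore] -/
theorem secondDiff01_torusGreen_swapPairs (z : Site 4 L) :
    (2 * torusGreen (![z 2, z 3, z 0, z 1] : Site 4 L) - torusGreen ((![z 2, z 3, z 0, z 1] : Site 4 L) + Pi.single 0 1) -
        torusGreen ((![z 2, z 3, z 0, z 1] : Site 4 L) - Pi.single 0 1)) +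
      (2 * torusGreen (![z 2, z 3, z 0, z 1] : Site 4 L) - torusGreen ((![z 2, z 3, z 0, z 1] : Site 4 L) + Pi.single 1 1) -
        torusGreen ((![z 2, z 3, z 0, z 1] : Site 4 L) - Pi.single 1 1)) =
      (2 * torusGreen z - torusGreen (z + Pi.single 2 1) - torusGreen (z - Pi.single 2 1)) +
        (2 * torusGreen z - torusGreen (z + Pi.single 3 1) - torusGreen (z - Pi.single 3 1)) := by
  obtain ⟨h1, h2, h3, h4⟩ := swapPairs_shift z
  rw [h1, h2, h3, h4, torusGreen_swapPairs, torusGreen_swapPairs, torusGreen_swapPairs, torusGreen_swapPairs,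
    torusGreen_swapPairs]

/-! ## §3 Box sums on `ℤ⁴`: the swap trick and injectivity of the projection -/

omit [NeZero L] in
/-- The cube `B_N = {−N,…,N}⁴` is mapped into itself by the coordinate-pair swap. [folklore] -/
theorem swapPairs_mem_box {N : ℕ} {x : Literature.Probability.LatticeModels.Site 4} (hx : x ∈ box 4 N) :
    (![x 2, x 3, x 0, x 1] : Literature.Probability.LatticeModels.Site 4) ∈ box 4 N := by
  rw [mem_box] at hx ⊢
  intro i
  fin_cases i
  · simpa using hx 2
  · simpa using hx 3
  · simpa using hx 0
  · simpa using hx 1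

omit [NeZero L] in
/-- **Double box sums of a kernel with a swap identity** (the tree's `FreeDipoleBoxMeanHalf` trick, general right-hand side):
if `K(z) + K(Tz) = R(z)` for the coordinate-pair swap `T`, then `2 ∑_{x,y ∈ B_N} K(x − y) = ∑_{x,y ∈ B_N} R(x − y)` (reindex both
sums by the involution `T`, which preserves the cube `B_N` and commutes with subtraction). [folklore] -/
theorem two_mul_sum_sum_box_of_add_swapPairs (K R : Literature.Probability.LatticeModels.Site 4 → ℝ)
    (hK : ∀ z : Literature.Probability.LatticeModels.Site 4,
      K z + K (![z 2, z 3, z 0, z 1] : Literature.Probability.LatticeModels.Site 4) = R z) (N : ℕ) :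
    2 * ∑ x ∈ box 4 N, ∑ y ∈ box 4 N, K (x - y) = ∑ x ∈ box 4 N, ∑ y ∈ box 4 N, R (x - y) := by
  have hinv : ∀ x : Literature.Probability.LatticeModels.Site 4,
      (![(![x 2, x 3, x 0, x 1] : Literature.Probability.LatticeModels.Site 4) 2,
        (![x 2, x 3, x 0, x 1] : Literature.Probability.LatticeModels.Site 4) 3,
        (![x 2, x 3, x 0, x 1] : Literature.Probability.LatticeModels.Site 4) 0,
        (![x 2, x 3, x 0, x 1] : Literature.Probability.LatticeModels.Site 4) 1] :
          Literature.Probability.LatticeModels.Site 4) = x := by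
    intro x; funext i; fin_cases i <;> simp
  have hswap : ∑ x ∈ box 4 N, ∑ y ∈ box 4 N, K (x - y) =
      ∑ x ∈ box 4 N, ∑ y ∈ box 4 N,
        K (![(x - y) 2, (x - y) 3, (x - y) 0, (x - y) 1] : Literature.Probability.LatticeModels.Site 4) := by
    refine Finset.sum_nbij' (fun x => (![x 2, x 3, x 0, x 1] : Literature.Probability.LatticeModels.Site 4))
      (fun x => (![x 2, x 3, x 0, x 1] : Literature.Probability.LatticeModels.Site 4))
      (fun x hx => swapPairs_mem_box hx) (fun x hx => swapPairs_mem_box hx) (fun x _ => hinv x) (fun x _ => hinv x)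
      (fun x _ => ?_)
    refine Finset.sum_nbij' (fun y => (![y 2, y 3, y 0, y 1] : Literature.Probability.LatticeModels.Site 4))
      (fun y => (![y 2, y 3, y 0, y 1] : Literature.Probability.LatticeModels.Site 4))
      (fun y hy => swapPairs_mem_box hy) (fun y hy => swapPairs_mem_box hy) (fun y _ => hinv y) (fun y _ => hinv y)
      (fun y _ => ?_)
    congr 1
    funext i
    fin_cases i <;> simp
  rw [two_mul]
  nth_rewrite 2 [hswap]
  rw [← Finset.sum_add_distrib]
  refine Finset.sum_congr rfl fun x _ => ?_
  rw [← Finset.sum_add_distrib]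
  exact Finset.sum_congr rfl fun y _ => hK (x - y)

omit [NeZero L] in
/-- **Injectivity of `B_N → (ℤ/L)⁴` for `L > 2N`.** [folklore] -/
theorem eq_of_torusProj_eq_of_mem_box {N : ℕ} (hL : 2 * N < L) {x y : Literature.Probability.LatticeModels.Site 4}
    (hx : x ∈ box 4 N) (hy : y ∈ box 4 N) (h : Torus.proj L x = Torus.proj L y) : x = y := by
  rw [mem_box] at hx hy
  funext i
  have hi := congrFun h i
  simp only [Torus.proj] at hi
  rw [ZMod.intCast_eq_intCast_iff_dvd_sub] at hi
  have habs : |y i - x i| < (L : ℤ) := by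
    rw [abs_lt]
    obtain ⟨hx1, hx2⟩ := hx i
    obtain ⟨hy1, hy2⟩ := hy i
    constructor <;> omega
  have h0 : y i - x i = 0 := Int.eq_zero_of_abs_lt_dvd hi habs
  omega

omit [NeZero L] in
/-- On the box, `[(x − y)‾ = 0] = [x = y]` for `L > 2N`. [folklore] -/
theorem torusProj_sub_eq_zero_iff {N : ℕ} (hL : 2 * N < L) {x y : Literature.Probability.LatticeModels.Site 4}
    (hx : x ∈ box 4 N) (hy : y ∈ box 4 N) : Torus.proj L (x - y) = 0 ↔ x = y := by
  rw [torusProj_sub, sub_eq_zero]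
  exact ⟨fun h => eq_of_torusProj_eq_of_mem_box hL hx hy h, fun h => by rw [h]⟩

/-! ## §4 The exact-sector sum and the fibre weights -/

/-- Fibrewise regrouping: `∑_y #{x ∈ B_N : x̄ = y}·F(y) = ∑_{x ∈ B_N} F(x̄)`. [folklore] -/
theorem sum_boxWeight_mul (N : ℕ) (F : Site 4 L → ℝ) :
    ∑ y : Site 4 L, (((box 4 N).filter (fun x => Torus.proj L x = y)).card : ℝ) * F y =
      ∑ x ∈ box 4 N, F (Torus.proj L x) := by
  rw [← Finset.sum_fiberwise (box 4 N) (Torus.proj L) (fun x => F (Torus.proj L x))]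
  refine Finset.sum_congr rfl fun y _ => ?_
  rw [Finset.sum_congr rfl (fun x (hx : x ∈ (box 4 N).filter (fun x => Torus.proj L x = y)) =>
      show F (Torus.proj L x) = F y by rw [(Finset.mem_filter.mp hx).2]), Finset.sum_const, nsmul_eq_mul]

/-- `∑_y #{x ∈ B_N : x̄ = y} = #B_N`. [folklore] -/
theorem sum_boxWeight (N : ℕ) :
    ∑ y : Site 4 L, (((box 4 N).filter (fun x => Torus.proj L x = y)).card : ℝ) = ((box 4 N).card : ℝ) := by
  have h := sum_boxWeight_mul (L := L) N (fun _ => 1)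
  simpa using h

/-- For `L > 2N` every fibre has at most one point, so `∑_y #{x ∈ B_N : x̄ = y}² = #B_N`. [folklore] -/
theorem sum_boxWeight_sq {N : ℕ} (hL : 2 * N < L) :
    ∑ y : Site 4 L, (((box 4 N).filter (fun x => Torus.proj L x = y)).card : ℝ) ^ 2 = ((box 4 N).card : ℝ) := by
  rw [← sum_boxWeight (L := L) N]
  refine Finset.sum_congr rfl fun y _ => ?_
  have hle : ((box 4 N).filter (fun x => Torus.proj L x = y)).card ≤ 1 :=
    Finset.card_le_one.mpr fun x hx x' hx' =>
      eq_of_torusProj_eq_of_mem_box hL (Finset.mem_filter.mp hx).1 (Finset.mem_filter.mp hx').1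
        ((Finset.mem_filter.mp hx).2.trans (Finset.mem_filter.mp hx').2.symm)
  rcases Nat.le_one_iff_eq_zero_or_eq_one.mp hle with h | h <;> simp [h]

/-- **The exact-sector sum.**  For the box potential `g = ½ ∑_{x ∈ B_N} G̃(· − x̄)` and `L > 2N`:
`∑_y #{x ∈ B_N : x̄ = y}·((−Δ₀−Δ₁)g)(y) = (#B_N − #B_N²/L⁴)/2` — by the swap symmetry the `(0,1)` and `(2,3)` sums agree, and
their total is the Poisson right-hand side summed over the box. [cite: FrohlichSpencer1982, §2] -/
theorem boxWeight_secondDiff01_sum {N : ℕ} (hL : 2 * N < L) (g : Site 4 L → ℝ)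
    (hg : ∀ y : Site 4 L, g y = 1 / 2 * ∑ x ∈ box 4 N, torusGreen (y - Torus.proj L x)) :
    ∑ y : Site 4 L, (((box 4 N).filter (fun x => Torus.proj L x = y)).card : ℝ) *
        ((2 * g y - g (y + Pi.single 0 1) - g (y - Pi.single 0 1)) +
          (2 * g y - g (y + Pi.single 1 1) - g (y - Pi.single 1 1))) =
      (((box 4 N).card : ℝ) - ((box 4 N).card : ℝ) ^ 2 / (L : ℝ) ^ 4) / 2 := by
  -- the (0,1) second differences of the box potential, as a box sum of second differences of `G̃`
  have harg₁ : ∀ (w : Site 4 L) (μ : Fin 4) (x : Literature.Probability.LatticeModels.Site 4),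
      w + Pi.single μ 1 - Torus.proj L x = (w - Torus.proj L x) + Pi.single μ 1 := fun w μ x => by abel
  have harg₂ : ∀ (w : Site 4 L) (μ : Fin 4) (x : Literature.Probability.LatticeModels.Site 4),
      w - Pi.single μ 1 - Torus.proj L x = (w - Torus.proj L x) - Pi.single μ 1 := fun w μ x => by abel
  have hA : ∀ w : Site 4 L,
      (2 * g w - g (w + Pi.single 0 1) - g (w - Pi.single 0 1)) + (2 * g w - g (w + Pi.single 1 1) - g (w - Pi.single 1 1)) =
        1 / 2 * ∑ x ∈ box 4 N,
          ((2 * torusGreen (w - Torus.proj L x) - torusGreen (w - Torus.proj L x + Pi.single 0 1) -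
              torusGreen (w - Torus.proj L x - Pi.single 0 1)) +
            (2 * torusGreen (w - Torus.proj L x) - torusGreen (w - Torus.proj L x + Pi.single 1 1) -
              torusGreen (w - Torus.proj L x - Pi.single 1 1))) := by
    intro w
    simp_rw [hg, harg₁, harg₂]
    rw [Finset.mul_sum, Finset.mul_sum, Finset.mul_sum, Finset.mul_sum, Finset.mul_sum, Finset.mul_sum]
    rw [Finset.mul_sum, ← Finset.sum_sub_distrib, ← Finset.sum_sub_distrib, ← Finset.sum_sub_distrib,
      ← Finset.sum_sub_distrib, ← Finset.sum_add_distrib]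
    exact Finset.sum_congr rfl fun x _ => by ring
  -- the kernel on `ℤ⁴` and its swap identity
  set K : Literature.Probability.LatticeModels.Site 4 → ℝ := fun v =>
    (2 * torusGreen (Torus.proj L v) - torusGreen (Torus.proj L v + Pi.single 0 1) - torusGreen (Torus.proj L v - Pi.single 0 1)) +
      (2 * torusGreen (Torus.proj L v) - torusGreen (Torus.proj L v + Pi.single 1 1) -
        torusGreen (Torus.proj L v - Pi.single 1 1)) with hK
  have hproj_swap : ∀ v : Literature.Probability.LatticeModels.Site 4,
      Torus.proj L (![v 2, v 3, v 0, v 1] : Literature.Probability.LatticeModels.Site 4) =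
        (![(Torus.proj L v) 2, (Torus.proj L v) 3, (Torus.proj L v) 0, (Torus.proj L v) 1] : Site 4 L) := by
    intro v; funext i; fin_cases i <;> simp [Torus.proj]
  have hKR : ∀ v : Literature.Probability.LatticeModels.Site 4,
      K v + K (![v 2, v 3, v 0, v 1] : Literature.Probability.LatticeModels.Site 4) =
        2 * ((if Torus.proj L v = 0 then (1 : ℝ) else 0) - 1 / (L : ℝ) ^ 4) := by
    intro v
    rw [← sum_secondDiff_torusGreen (Torus.proj L v), Fin.sum_univ_four, hK]
    simp only
    rw [hproj_swap, secondDiff01_torusGreen_swapPairs]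
    ring
  -- regroup the weighted sum over the box and apply the swap trick
  rw [sum_boxWeight_mul N]
  have hB : ∀ x' ∈ box 4 N,
      (2 * g (Torus.proj L x') - g (Torus.proj L x' + Pi.single 0 1) - g (Torus.proj L x' - Pi.single 0 1)) +
          (2 * g (Torus.proj L x') - g (Torus.proj L x' + Pi.single 1 1) - g (Torus.proj L x' - Pi.single 1 1)) =
        1 / 2 * ∑ x ∈ box 4 N, K (x' - x) := by
    intro x' _
    rw [hA]
    congr 1
    refine Finset.sum_congr rfl fun x _ => ?_
    rw [hK]
    simp only [torusProj_sub]
  rw [Finset.sum_congr rfl hB, ← Finset.mul_sum]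
  have hswap := two_mul_sum_sum_box_of_add_swapPairs K _ hKR N
  have hR : ∑ x ∈ box 4 N, ∑ y ∈ box 4 N, 2 * ((if Torus.proj L (x - y) = 0 then (1 : ℝ) else 0) - 1 / (L : ℝ) ^ 4) =
      2 * (((box 4 N).card : ℝ) - ((box 4 N).card : ℝ) ^ 2 / (L : ℝ) ^ 4) := by
    have hrow : ∀ x ∈ box 4 N,
        ∑ y ∈ box 4 N, 2 * ((if Torus.proj L (x - y) = 0 then (1 : ℝ) else 0) - 1 / (L : ℝ) ^ 4) =
          2 * (1 - ((box 4 N).card : ℝ) / (L : ℝ) ^ 4) := by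
      intro x hx
      rw [← Finset.mul_sum, Finset.sum_sub_distrib, Finset.sum_const, nsmul_eq_mul]
      congr 1
      rw [Finset.sum_congr rfl fun y hy => show (if Torus.proj L (x - y) = 0 then (1 : ℝ) else 0) =
          (if x = y then (1 : ℝ) else 0) by simp only [torusProj_sub_eq_zero_iff hL hx hy],
        Finset.sum_ite_eq, if_pos hx]
      ring
    rw [Finset.sum_congr rfl hrow, Finset.sum_const, nsmul_eq_mul]
    ring
  rw [hR] at hswap
  linarith

end Summit.QuantumFields.YangMills.Theorems.TransverseWardBL

end
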